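import Literature.Analysis.FluidPDE.OseenHeatDivFree
import Literature.Analysis.FluidPDE.MildSolution
import Literature.Analysis.FluidPDE.KNSSRegularityDecomposition
import Literature.Analysis.FluidPDE.OseenDuhamelMeasurable
import HarnessLib

/-!
# The Oseen–heat Duhamel operator of bounded measurable fields

Analysis/FluidPDE support file, third layer of the discharge of the named fact
`Literature.Analysis.FluidPDE.classical_of_bounded_mild_L3` (`MildL3Smooth.lean`: bounded mild
solutions in `C([0,T); L³)` are classical; Lemarié-Rieusset 2016, Thm. 9.12;
Koch–Nadirashvili–Seregin–Šverák 2009, §4). With the tree's physical-space realisation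
`oseenHeat τ F i` of `(e^{τΔ} P ∇·F)ᵢ` (`OseenHeat.lean`) we define, for time-dependent fields
`u v : ℝ → E → E`, a viscosity `ν` and a base time `s`, the **Duhamel (Oseen) bilinear term**

  `oseenHeatDuhamel ν s u v t i x = ∫_{τ ∈ (s,t)} (𝒩_{ν(t-τ)} (u(τ) ⊗ v(τ)))ᵢ (x) dτ`,
  `oseenHeatDuhamelVec ν s u v t x = ∑ᵢ oseenHeatDuhamel ν s u v t i x • bᵢ`,

the tensor `u ⊗ v` being taken in the frame `b = stdOrthonormalBasis ℝ E`
(`frameTensor u v j k = ⟪u, bⱼ⟫ ⟪v, bₖ⟫`), so that the Oseen/Duhamel formula of a mild solution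
reads `u(t) = e^{ν(t-s)Δ}u(s) - oseenHeatDuhamelVec ν s u u t` (Lemarié-Rieusset 2016, (9.37) and
Thm. 5.1 / §6.2; KNSS 2009, §4, `u = U + B(u,u)` with `B(u,v)ᵢ = -∫∫ K_{ijk}(x-y,t-s) uₖvⱼ`).

For **bounded, jointly (strongly) measurable** fields (`‖u‖ ≤ Mᵤ`, `‖v‖ ≤ Mᵥ` everywhere) this
file proves:

* measurability of the integrand `τ ↦ (𝒩_{ν(t-τ)}(u(τ) ⊗ v(τ)))ᵢ(x)` at **every** point `x`
  (an everywhere/strongly-measurable version of the tree's parametric measurability of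
  `oseenHeat`, `stronglyMeasurable_oseenHeat_param`), and joint measurability in `(τ, x)`;
* in dimension 3 (`hE : finrank ℝ E = 3`, where the tree's `L^∞` bound of `oseenHeat` lives):
  the kernel bound `|(𝒩_{ν(t-τ)}(u ⊗ v))ᵢ(x)| ≤ 2943 (ν(t-τ))^{-1/2} MᵤMᵥ`, integrability on
  `(s, t)`, and `|oseenHeatDuhamel| ≤ 5886 ν^{-1/2} (t-s)^{1/2} MᵤMᵥ` (KNSS 2009, (4.5):
  `‖B(u,v)‖_∞ ≤ C√T ‖u‖_∞‖v‖_∞`; Lemarié-Rieusset 2016, proof of Thm. 9.12, the constant `C₀`);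
* the **pairing identity** against smooth compactly supported divergence-free `φ`
  (`integral_inner_oseenHeatDuhamelVec`):
  `∫ ⟪B_s(u,v)(t), φ⟫ = -∫_{τ∈(s,t)} ∫ ⟪v(τ), (u(τ)·∇) e^{ν(t-τ)Δ}φ⟫`, i.e. the Duhamel term
  reproduces the nonlinear term of the duality form `Fluid.IsMildNSSolutionBetween`;
* **weak divergence-freeness** of `B_s(u,v)(t)` (`isWeaklyDivFree_oseenHeatDuhamelVec`).

Nothing here is specific to Navier–Stokes solutions; the identification of a duality-form mild
solution with its Oseen representative is in the next file.

## Relation to the tree's other Duhamel objects (one notion)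

* `driftTensor U b σ` (`KNSSRegularityDecomposition.lean`) **is** `frameTensor` of the full
  velocity `U σ + b σ` with itself (`driftTensor_eq_frameTensor`, `rfl`), and the drift Duhamel
  integral `driftDuhamel U b s t` (ibid., unit viscosity, quadratic, interval integral with the
  frame sum inside) is the case `ν = 1` of `oseenHeatDuhamelVec` on the field `U + b`
  (`driftDuhamel_eq_oseenHeatDuhamelVec`, for `s ≤ t` and bounded jointly measurable `U + b`,
  where the component integrands are integrable). `OseenDuhamelMeasurable.lean` already treats
  the Duhamel integral `∫ ∑ᵢ oseenHeat (c τ) (F τ) i x • bᵢ dτ` of an ARBITRARY bounded, jointly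
  measurable tensor forcing `F : ℝ → Fin d → Fin d → E → ℝ` with a measurable clock `c`
  (`memLp_top_slice_of_bound`, `aestronglyMeasurable_oseenHeat_clock_prod` — which gives this
  file's `aestronglyMeasurable_oseenDuhamelIntegrand_prod` with `c τ = ν(t-τ)` —,
  `aestronglyMeasurable_oseenHeat_sub_section`, `norm_oseenHeat_duhamelIntegrand_le`,
  `intervalIntegrable_sum_oseenHeat_sub_smul`, `norm_integral_sum_oseenHeat_sub_smul_le`,
  continuity in `t` and in `(t, x)`, the restart identity
  `integral_sum_oseenHeat_duhamel_eq_heatExtension_add`), specialising to `driftTensor` only in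
  its last section (`norm_driftDuhamel_le`, `continuous_driftDuhamel`, …); and
  `OseenDuhamelWeakStokes.lean` has the pairing/weak-divergence results for `driftDuhamel`
  (`integral_inner_driftDuhamel_zero_eq`, `isWeaklyDivFree_driftDuhamel_zero`). What is NEW here:
  the `ν`-clock **set-integral** form over `Ioo s t` with the frame sum outside
  (`oseenHeatDuhamel`/`oseenHeatDuhamelVec` as named operators on pairs `(u, v)` of vector
  fields), **everywhere** (not a.e.) strong measurability of the `τ`-sections at every `x` and
  joint strong measurability of `uncurry (oseenHeatDuhamel ν s u v · i ·)` in `(t, x)`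
  (`stronglyMeasurable_uncurry_oseenHeatDuhamel`, needed to feed the term back into itself), the
  Fubini identity against `L¹` functions (`integral_oseenHeatDuhamel_mul`), and the pairing
  identity and weak divergence-freeness for the general **bilinear** `(u, v)`; the singular-weight
  lemmas are taken from `OseenDuhamelMeasurable.lean` (`intervalIntegrable_rpow_neg_half_sub`,
  `integral_rpow_neg_half_sub_eq`). The bilinear operator is needed because the Oseen/Picard
  scheme and the regularity bootstrap manipulate `B(v, w)` with `v ≠ w` (Lemarié-Rieusset 2016,
  p. 260, (9.38): `B(V_j, V_{k-j})`).
* `oseenDuhamel ν s u v` (`NSBoundedMildOseen.lean`) is the same operator realised through the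
  Oseen–Koch–Tataru **kernel** `oseenKernel` instead of the heat-flow layers `oseenHeat`; both
  satisfy the same pairing identity against solenoidal tests and are weakly divergence free
  (`NSBoundedMildOseenDuhamel.lean`), so they agree a.e. slicewise on bounded `L³` fields by the
  annihilator lemma; the pointwise bridge is left to a follow-up file.
* The single-slice pairing used inside `integral_inner_oseenHeatDuhamelVec` and the frame algebra
  `sum_sum_frameTensor_mul_heatD1_eq` also exist, in the `Lᵖ`–`L^{p'}` form, as
  `integral_inner_sum_oseenHeat_tensor_eq_neg`, `heatD1_inner_const_eq` and
  `sum_sum_inner_mul_inner_mul_inner_apply` of `OseenHeatDuality.lean` (the pairing lineage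
  `OseenHeatWeakDiv`/`OseenHeatDuality`, landed the same day as `OseenHeatPairing`/`OseenHeatDivFree`,
  on which this file is built; the two lineages prove the same identities).

## Mathlib / tree search

Tree: `oseenHeat` with `norm_oseenHeat_le_of_top`, `memLp_top_oseenHeat`, `contDiff_oseenHeat`,
`heatD1_eq_convolution`, `heatD3_eq_heatD1_heatD1_heatD1`, `measurable_fderiv_heatKernel_apply_uncurry`
(`OseenHeat*`); the pairing identities `integral_sum_oseenHeat_mul_inner_eq`,
`integral_sum_oseenHeat_mul_fderiv_eq_zero` (`OseenHeatPairing`, `OseenHeatDivFree`);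
`driftTensor`, `driftDuhamel` (`KNSSRegularityDecomposition`); `heatTest_of_pos`, `convect`
(`MildSolution`, `VectorCalculus`). Mathlib: `StronglyMeasurable.integral_prod_right'`,
`integral_integral_swap`, `Integrable.mono'`, `OrthonormalBasis.sum_repr'`,
`OrthonormalBasis.sum_inner_mul_inner`, `integral_comp_sub_left`.

## References

* P. G. Lemarié-Rieusset, *The Navier–Stokes Problem in the 21st Century*, CRC Press 2016,
  Thm. 5.1 (Oseen's `L^∞` theory), §6.2, (9.37)–(9.38) in the proof of Thm. 9.12.
  [LemarieRieusset2016]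
* G. Koch, N. Nadirashvili, G. Seregin, V. Šverák, Acta Math. 203 (2009) = arXiv:0709.3599, §3,
  (3.7) (the kernel bound `|K_{ijk}| ≤ C(|x|²+t)^{-(n+1)/2}`); §4, (4.3) (the operator `B`),
  (4.4) (`u = U + B(u,u)`), (4.5) (`‖B(u,v)‖ ≤ C√T‖u‖‖v‖`). [KochNadirashviliSereginSverak2009]
-/

open MeasureTheory Filter Set InnerProductSpace Function
open scoped Real ENNReal NNReal Laplacian RealInnerProductSpace Topology

noncomputable section

namespace Literature.Analysis.FluidPDE

variable {E : Type*} [NormedAddCommGroup E] [InnerProductSpace ℝ E] [FiniteDimensional ℝ E]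
  [MeasurableSpace E] [BorelSpace E]

/-! ## The frame tensor `u ⊗ v` -/

section FrameTensor

/-- The components of the tensor `u ⊗ v` of two vector fields along the frame
`b = stdOrthonormalBasis ℝ E`: `(u ⊗ v)ⱼₖ(y) = ⟪u y, bⱼ⟫ ⟪v y, bₖ⟫`, the matrix field fed to
the Oseen–heat operator (`oseenHeat`) in the Duhamel term `e^{τΔ}P∇·(u ⊗ v)`
(Lemarié-Rieusset 2016, (9.37)). [cite: LemarieRieusset2016, (9.37)] -/
def frameTensor (u v : E → E) (j k : Fin (Module.finrank ℝ E)) (y : E) : ℝ :=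
  ⟪u y, stdOrthonormalBasis ℝ E j⟫ * ⟪v y, stdOrthonormalBasis ℝ E k⟫

omit [MeasurableSpace E] [BorelSpace E] in
/-- Unfolding `frameTensor`. [folklore] -/
@[simp]
theorem frameTensor_apply (u v : E → E) (j k : Fin (Module.finrank ℝ E)) (y : E) :
    frameTensor u v j k y = ⟪u y, stdOrthonormalBasis ℝ E j⟫ * ⟪v y, stdOrthonormalBasis ℝ E k⟫ :=
  rfl

omit [MeasurableSpace E] [BorelSpace E] in
/-- `|(u ⊗ v)ⱼₖ(y)| ≤ ‖u y‖ ‖v y‖` (the frame vectors are unit vectors). [folklore] -/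
theorem norm_frameTensor_le (u v : E → E) (j k : Fin (Module.finrank ℝ E)) (y : E) :
    ‖frameTensor u v j k y‖ ≤ ‖u y‖ * ‖v y‖ := by
  rw [frameTensor, norm_mul]
  have h1 : ‖⟪u y, stdOrthonormalBasis ℝ E j⟫‖ ≤ ‖u y‖ :=
    (norm_inner_le_norm _ _).trans (mul_le_of_le_one_right (norm_nonneg _)
      (norm_stdOrthonormalBasis_le_one j))
  have h2 : ‖⟪v y, stdOrthonormalBasis ℝ E k⟫‖ ≤ ‖v y‖ :=
    (norm_inner_le_norm _ _).trans (mul_le_of_le_one_right (norm_nonneg _)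
      (norm_stdOrthonormalBasis_le_one k))
  exact mul_le_mul h1 h2 (norm_nonneg _) (norm_nonneg _)

/-- The frame tensor of (a.e. strongly) measurable fields is a.e. strongly measurable. [folklore] -/
theorem aestronglyMeasurable_frameTensor {u v : E → E} (hu : AEStronglyMeasurable u volume)
    (hv : AEStronglyMeasurable v volume) (j k : Fin (Module.finrank ℝ E)) :
    AEStronglyMeasurable (frameTensor u v j k) volume :=
  hu.inner_const.mul hv.inner_const

/-- The frame tensor of bounded measurable fields is in `L^∞` with
`‖(u ⊗ v)ⱼₖ‖_∞ ≤ MᵤMᵥ`. [folklore] -/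
theorem memLp_top_frameTensor {u v : E → E} (hu : AEStronglyMeasurable u volume)
    (hv : AEStronglyMeasurable v volume) {Mu Mv : ℝ} (huM : ∀ y, ‖u y‖ ≤ Mu) (hvM : ∀ y, ‖v y‖ ≤ Mv)
    (j k : Fin (Module.finrank ℝ E)) :
    MemLp (frameTensor u v j k) ∞ volume ∧
      eLpNorm (frameTensor u v j k) ∞ volume ≤ ENNReal.ofReal (Mu * Mv) := by
  have hb : ∀ y, ‖frameTensor u v j k y‖ ≤ Mu * Mv := fun y =>
    (norm_frameTensor_le u v j k y).trans
      (mul_le_mul (huM y) (hvM y) (norm_nonneg _) ((norm_nonneg _).trans (huM y)))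
  refine ⟨memLp_top_of_bound (aestronglyMeasurable_frameTensor hu hv j k) _
    (Eventually.of_forall hb), ?_⟩
  rw [eLpNorm_exponent_top]
  exact eLpNormEssSup_le_of_ae_bound (Eventually.of_forall hb)

omit [BorelSpace E] in
/-- Joint strong measurability of `(τ, y) ↦ (u(τ) ⊗ v(τ))ⱼₖ(y)` for jointly measurable
fields. [folklore] -/
theorem stronglyMeasurable_frameTensor_uncurry {u v : ℝ → E → E}
    (hu : StronglyMeasurable (uncurry u)) (hv : StronglyMeasurable (uncurry v))
    (j k : Fin (Module.finrank ℝ E)) :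
    StronglyMeasurable (fun q : ℝ × E => frameTensor (u q.1) (v q.1) j k q.2) :=
  (hu.inner stronglyMeasurable_const).mul (hv.inner stronglyMeasurable_const)

end FrameTensor

/-! ## Everywhere (strong) measurability of the Oseen–heat operator with measurable data -/

section ParamMeasurability

variable {P : Type*} [MeasurableSpace P]

/-- `(p, x) ↦ ∫ k(p, x - y) L(p, y) dy` is (strongly) measurable for jointly measurable
real `k`, `L` — everywhere version of the tree's `aestronglyMeasurable_integral_sub_mul_param`.
[folklore] -/
theorem stronglyMeasurable_integral_sub_mul_param {k L : P × E → ℝ} (hk : StronglyMeasurable k)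
    (hL : StronglyMeasurable L) :
    StronglyMeasurable (fun q : P × E => ∫ y, k (q.1, q.2 - y) * L (q.1, y)) := by
  have h1 : Measurable (fun r : (P × E) × E => (r.1.1, r.1.2 - r.2)) :=
    (measurable_fst.comp measurable_fst).prodMk ((measurable_snd.comp measurable_fst).sub measurable_snd)
  have h2 : Measurable (fun r : (P × E) × E => (r.1.1, r.2)) :=
    (measurable_fst.comp measurable_fst).prodMk measurable_snd
  have hF : StronglyMeasurable (fun r : (P × E) × E => k (r.1.1, r.1.2 - r.2) * L (r.1.1, r.2)) :=
    (hk.comp_measurable h1).mul (hL.comp_measurable h2)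
  exact hF.integral_prod_right' (ν := (volume : Measure E))

/-- **Everywhere measurability of `(p, x) ↦ ∂ᵥ e^{c(p)Δ} g_p (x)`** for jointly measurable data
`g`, every slice `g_p ∈ L^{p₀}`, and a measurable positive clock `c`. [folklore] -/
theorem stronglyMeasurable_heatD1_param {c : P → ℝ} (hc : Measurable c) (hc0 : ∀ p, 0 < c p)
    {g : P × E → ℝ} (hg : StronglyMeasurable g) {p₀ : ℝ≥0∞} (hp₀ : 1 ≤ p₀)
    (hgp : ∀ p, MemLp (fun y => g (p, y)) p₀ volume) (v : E) :
    StronglyMeasurable (fun q : P × E => heatD1 (c q.1) v (fun y => g (q.1, y)) q.2) := by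
  have hk : StronglyMeasurable (fun q : P × E => fderiv ℝ (UnboundedOperators.heatKernel (c q.1)) q.2 v) :=
    ((measurable_fderiv_heatKernel_apply_uncurry v).comp
      ((hc.comp measurable_fst).prodMk measurable_snd)).stronglyMeasurable
  have h := stronglyMeasurable_integral_sub_mul_param hk hg
  have hfun : (fun q : P × E => heatD1 (c q.1) v (fun y => g (q.1, y)) q.2) =
      fun q : P × E => ∫ y, fderiv ℝ (UnboundedOperators.heatKernel (c q.1)) (q.2 - y) v * g (q.1, y) := by
    funext q
    rw [heatD1_eq_convolution (hgp q.1) hp₀ (hc0 q.1) v, MeasureTheory.convolution_lsmul_swap]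
    rfl
  rw [hfun]
  exact h

/-- Everywhere measurability of `(p, x) ↦ ∂³ e^{c(p)Δ} g_p (x)` (three layers). [folklore] -/
theorem stronglyMeasurable_heatD3_param {c : P → ℝ} (hc : Measurable c) (hc0 : ∀ p, 0 < c p)
    {g : P × E → ℝ} (hg : StronglyMeasurable g) {p₀ : ℝ≥0∞} (hp₀ : 1 ≤ p₀)
    (hgp : ∀ p, MemLp (fun y => g (p, y)) p₀ volume) (u v w : E) :
    StronglyMeasurable (fun q : P × E => heatD3 (c q.1) u v w (fun y => g (q.1, y)) q.2) := by
  have hc3 : Measurable fun p => c p / 3 := hc.div_const 3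
  have hc30 : ∀ p, 0 < c p / 3 := fun p => by have := hc0 p; positivity
  set g₁ : P × E → ℝ := fun q => heatD1 (c q.1 / 3) w (fun y => g (q.1, y)) q.2 with hg₁_def
  have hg₁ : StronglyMeasurable g₁ := stronglyMeasurable_heatD1_param hc3 hc30 hg hp₀ hgp w
  have hg₁p : ∀ p, MemLp (fun y => g₁ (p, y)) p₀ volume := fun p =>
    memLp_heatD1 (hgp p) hp₀ (hc30 p) w
  set g₂ : P × E → ℝ := fun q => heatD1 (c q.1 / 3) v (fun y => g₁ (q.1, y)) q.2 with hg₂_def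
  have hg₂ : StronglyMeasurable g₂ := stronglyMeasurable_heatD1_param hc3 hc30 hg₁ hp₀ hg₁p v
  have hg₂p : ∀ p, MemLp (fun y => g₂ (p, y)) p₀ volume := fun p =>
    memLp_heatD1 (hg₁p p) hp₀ (hc30 p) v
  have hg₃ := stronglyMeasurable_heatD1_param hc3 hc30 hg₂ hp₀ hg₂p u
  have hfun : (fun q : P × E => heatD3 (c q.1) u v w (fun y => g (q.1, y)) q.2) =
      fun q : P × E => heatD1 (c q.1 / 3) u (fun y => g₂ (q.1, y)) q.2 := by
    funext q
    have hs := heatD3_eq_heatD1_heatD1_heatD1 (hgp q.1) hp₀ (hc30 q.1) (hc30 q.1) (hc30 q.1) u v w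
    rw [show c q.1 / 3 + c q.1 / 3 + c q.1 / 3 = c q.1 by ring] at hs
    rw [hs]
  rw [hfun]
  exact hg₃

/-- Everywhere measurability of the Leray-correction integral
`(p, x) ↦ ∫₀^∞ ∂³ e^{(c(p)+σ)Δ} g_p (x) dσ`. [folklore] -/
theorem stronglyMeasurable_integral_Ioi_heatD3_param {c : P → ℝ} (hc : Measurable c)
    (hc0 : ∀ p, 0 < c p) {g : P × E → ℝ} (hg : StronglyMeasurable g) {p₀ : ℝ≥0∞} (hp₀ : 1 ≤ p₀)
    (hgp : ∀ p, MemLp (fun y => g (p, y)) p₀ volume) (u v w : E) :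
    StronglyMeasurable (fun q : P × E =>
      ∫ σ in Ioi (0:ℝ), heatD3 (c q.1 + σ) u v w (fun y => g (q.1, y)) q.2) := by
  -- a positive measurable clock on `P × ℝ` agreeing with `c p + σ` for `σ > 0`
  have hc'm : Measurable (fun p' : P × ℝ => c p'.1 + max p'.2 0) :=
    (hc.comp measurable_fst).add (measurable_snd.max measurable_const)
  have hc'0 : ∀ p' : P × ℝ, 0 < c p'.1 + max p'.2 0 := fun p' => by
    have h1 := hc0 p'.1
    have h2 : 0 ≤ max p'.2 0 := le_max_right _ _
    linarith
  have hg' : StronglyMeasurable (fun q' : (P × ℝ) × E => g (q'.1.1, q'.2)) :=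
    hg.comp_measurable ((measurable_fst.comp measurable_fst).prodMk measurable_snd)
  have hgp' : ∀ p' : P × ℝ, MemLp (fun y => g (p'.1, y)) p₀ volume := fun p' => hgp p'.1
  have h3 : StronglyMeasurable (fun q' : (P × ℝ) × E =>
      heatD3 (c q'.1.1 + max q'.1.2 0) u v w (fun y => g (q'.1.1, y)) q'.2) :=
    stronglyMeasurable_heatD3_param (c := fun p' : P × ℝ => c p'.1 + max p'.2 0)
      (g := fun q' : (P × ℝ) × E => g (q'.1.1, q'.2)) hc'm hc'0 hg' hp₀ hgp' u v w
  -- reassociate `((p, σ), x) ↔ ((p, x), σ)`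
  have hshuffle : Measurable (fun r : (P × E) × ℝ => (((r.1.1, r.2) : P × ℝ), r.1.2)) :=
    ((measurable_fst.comp measurable_fst).prodMk measurable_snd).prodMk
      (measurable_snd.comp measurable_fst)
  have h3' := h3.comp_measurable hshuffle
  have h4 := h3'.integral_prod_right' (ν := (volume : Measure ℝ).restrict (Ioi 0))
  have hfun : (fun q : P × E => ∫ σ in Ioi (0:ℝ), heatD3 (c q.1 + σ) u v w (fun y => g (q.1, y)) q.2) =
      fun q : P × E => ∫ σ in Ioi (0:ℝ), heatD3 (c q.1 + max σ 0) u v w (fun y => g (q.1, y)) q.2 := by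
    funext q
    refine setIntegral_congr_fun measurableSet_Ioi fun σ hσ => ?_
    have hσ' : (0:ℝ) < σ := hσ
    rw [max_eq_left hσ'.le]
  rw [hfun]
  simpa only [Function.comp_def] using h4

/-- **Everywhere measurability of the Oseen–heat operator with measurably varying data**:
`(p, x) ↦ (𝒩_{c(p)} G_p)ᵢ (x)` for jointly measurable `G`, every slice in `L^{p₀}`, and a
measurable positive clock (the everywhere version of the tree's
`aestronglyMeasurable_oseenHeat_param`). [folklore] -/
theorem stronglyMeasurable_oseenHeat_param {c : P → ℝ} (hc : Measurable c) (hc0 : ∀ p, 0 < c p)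
    {G : Fin (Module.finrank ℝ E) → Fin (Module.finrank ℝ E) → P × E → ℝ}
    (hG : ∀ j k, StronglyMeasurable (G j k)) {p₀ : ℝ≥0∞} (hp₀ : 1 ≤ p₀)
    (hGp : ∀ p j k, MemLp (fun y => G j k (p, y)) p₀ volume) (i : Fin (Module.finrank ℝ E)) :
    StronglyMeasurable (fun q : P × E => oseenHeat (c q.1) (fun j k y => G j k (q.1, y)) i q.2) := by
  unfold oseenHeat
  refine StronglyMeasurable.add (Finset.stronglyMeasurable_fun_sum _ fun j _ => ?_)
    (Finset.stronglyMeasurable_fun_sum _ fun j _ => Finset.stronglyMeasurable_fun_sum _ fun k _ => ?_)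
  · exact stronglyMeasurable_heatD1_param hc hc0 (hG j i) hp₀ (fun p => hGp p j i) _
  · exact stronglyMeasurable_integral_Ioi_heatD3_param hc hc0 (hG j k) hp₀ (fun p => hGp p j k) _ _ _

end ParamMeasurability

/-! ## Bounded jointly measurable fields -/

section BddField

/-- A **bounded, jointly (strongly) measurable time-dependent field** `u : ℝ → E → E`:
`(τ, x) ↦ u τ x` is strongly measurable on `ℝ × E` and `‖u τ x‖ ≤ M` everywhere — the
everywhere-defined representatives on which the Oseen–Duhamel integrals are taken pointwise
(KNSS 2009, §4: `u ∈ L^∞(ℝⁿ × (0,T))`; such representatives exist for essentially bounded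
jointly measurable classes, `BoundedRepresentative.lean`). [folklore] -/
structure IsBddMeasurableField (u : ℝ → E → E) (M : ℝ) : Prop where
  /-- joint strong measurability of `(τ, x) ↦ u τ x` -/
  stronglyMeasurable : StronglyMeasurable (uncurry u)
  /-- the everywhere bound `‖u τ x‖ ≤ M` -/
  norm_le : ∀ τ x, ‖u τ x‖ ≤ M

namespace IsBddMeasurableField

variable {u : ℝ → E → E} {M : ℝ}

omit [InnerProductSpace ℝ E] [FiniteDimensional ℝ E] [BorelSpace E] in
/-- The bound of a bounded field is nonnegative. [folklore] -/
theorem nonneg (hu : IsBddMeasurableField u M) : 0 ≤ M :=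
  (norm_nonneg _).trans (hu.norm_le 0 0)

omit [InnerProductSpace ℝ E] [FiniteDimensional ℝ E] [BorelSpace E] in
/-- Every time slice of a bounded measurable field is strongly measurable. [folklore] -/
theorem stronglyMeasurable_slice (hu : IsBddMeasurableField u M) (τ : ℝ) :
    StronglyMeasurable (u τ) :=
  hu.stronglyMeasurable.comp_measurable (measurable_const.prodMk measurable_id)

/-- Every time slice of a bounded measurable field is in `L^∞` with norm at most `M`. [folklore] -/
theorem memLp_top_slice (hu : IsBddMeasurableField u M) (τ : ℝ) :
    MemLp (u τ) ∞ volume ∧ eLpNorm (u τ) ∞ volume ≤ ENNReal.ofReal M := by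
  refine ⟨memLp_top_of_bound (hu.stronglyMeasurable_slice τ).aestronglyMeasurable _
    (Eventually.of_forall (hu.norm_le τ)), ?_⟩
  rw [eLpNorm_exponent_top]
  exact eLpNormEssSup_le_of_ae_bound (Eventually.of_forall (hu.norm_le τ))

/-- The frame tensor of two bounded measurable fields: every slice is in `L^∞` with
`‖(u(τ) ⊗ v(τ))ⱼₖ‖_∞ ≤ MᵤMᵥ`. [folklore] -/
theorem memLp_top_frameTensor {v : ℝ → E → E} {Mv : ℝ} (hu : IsBddMeasurableField u M)
    (hv : IsBddMeasurableField v Mv) (τ : ℝ) (j k : Fin (Module.finrank ℝ E)) :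
    MemLp (frameTensor (u τ) (v τ) j k) ∞ volume ∧
      eLpNorm (frameTensor (u τ) (v τ) j k) ∞ volume ≤ ENNReal.ofReal (M * Mv) :=
  Literature.Analysis.FluidPDE.memLp_top_frameTensor
    (hu.stronglyMeasurable_slice τ).aestronglyMeasurable
    (hv.stronglyMeasurable_slice τ).aestronglyMeasurable (hu.norm_le τ) (hv.norm_le τ) j k

end IsBddMeasurableField

end BddField

/-! ## The Duhamel operator -/

section Duhamel

/-- The `i`-th frame component of the **Oseen–Duhamel bilinear term** from the base time `s`:
`oseenHeatDuhamel ν s u v t i x = ∫_{τ ∈ (s,t)} (𝒩_{ν(t-τ)} (u(τ) ⊗ v(τ)))ᵢ (x) dτ`, with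
`𝒩_σ = e^{σΔ}P∇·` realised by `oseenHeat` and `u ⊗ v` by `frameTensor` (a Bochner integral in
`τ` over `(s, t)`; zero for `t ≤ s`). For a mild solution `u` of the Navier–Stokes equations,
`u(t) = e^{ν(t-s)Δ}u(s) - ∑ᵢ (oseenHeatDuhamel ν s u u t i) bᵢ` (Lemarié-Rieusset 2016, (9.37) and
the expansion (9.38) in the proof of Thm. 9.12; KNSS 2009, (4.3)). [cite: LemarieRieusset2016, Thm. 9.12 (9.37)–(9.38)] -/
def oseenHeatDuhamel (ν s : ℝ) (u v : ℝ → E → E) (t : ℝ) (i : Fin (Module.finrank ℝ E))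
    (x : E) : ℝ :=
  ∫ τ in Ioo s t, oseenHeat (ν * (t - τ)) (frameTensor (u τ) (v τ)) i x

/-- The **Oseen–Duhamel bilinear term as a vector field**:
`oseenHeatDuhamelVec ν s u v t x = ∑ᵢ oseenHeatDuhamel ν s u v t i x • bᵢ`
(`b = stdOrthonormalBasis ℝ E`), i.e. `B_s(u,v)(t) = ∫ₛᵗ e^{ν(t-τ)Δ} P ∇·(u ⊗ v)(τ) dτ`
(Lemarié-Rieusset 2016, (9.37); KNSS 2009, (4.3)). [cite: LemarieRieusset2016, Thm. 9.12 (9.37)] -/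
def oseenHeatDuhamelVec (ν s : ℝ) (u v : ℝ → E → E) (t : ℝ) (x : E) : E :=
  ∑ i, oseenHeatDuhamel ν s u v t i x • stdOrthonormalBasis ℝ E i

/-- Unfolding `oseenHeatDuhamel`. [folklore] -/
theorem oseenHeatDuhamel_apply (ν s : ℝ) (u v : ℝ → E → E) (t : ℝ)
    (i : Fin (Module.finrank ℝ E)) (x : E) :
    oseenHeatDuhamel ν s u v t i x =
      ∫ τ in Ioo s t, oseenHeat (ν * (t - τ)) (frameTensor (u τ) (v τ)) i x :=
  rfl

/-- Unfolding `oseenHeatDuhamelVec`. [folklore] -/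
theorem oseenHeatDuhamelVec_apply (ν s : ℝ) (u v : ℝ → E → E) (t : ℝ) (x : E) :
    oseenHeatDuhamelVec ν s u v t x =
      ∑ i, oseenHeatDuhamel ν s u v t i x • stdOrthonormalBasis ℝ E i :=
  rfl

/-- The frame components of the vector Duhamel term are the scalar Duhamel terms. [folklore] -/
theorem inner_oseenHeatDuhamelVec (ν s : ℝ) (u v : ℝ → E → E) (t : ℝ) (x : E)
    (i : Fin (Module.finrank ℝ E)) :
    ⟪oseenHeatDuhamelVec ν s u v t x, stdOrthonormalBasis ℝ E i⟫ = oseenHeatDuhamel ν s u v t i x := by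
  rw [oseenHeatDuhamelVec_apply, sum_inner]
  simp_rw [inner_smul_left]
  rw [Finset.sum_eq_single i]
  · simp
  · intro j _ hji
    simp [(stdOrthonormalBasis ℝ E).inner_eq_zero hji]
  · simp

/-- For `t ≤ s` the Duhamel term vanishes. [folklore] -/
theorem oseenHeatDuhamel_of_le {ν s t : ℝ} (hts : t ≤ s) (u v : ℝ → E → E)
    (i : Fin (Module.finrank ℝ E)) (x : E) : oseenHeatDuhamel ν s u v t i x = 0 := by
  rw [oseenHeatDuhamel_apply, Ioo_eq_empty (not_lt.2 hts), Measure.restrict_empty, integral_zero_measure]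

/-! ### Measurability of the integrand -/

/-- **Joint measurability of the Duhamel integrand in `(t, τ, x)`**: for bounded measurable
fields and `ν > 0`, `((t, τ), x) ↦ (𝒩_{ν c(t,τ)} (u(τ) ⊗ v(τ)))ᵢ(x)` is strongly measurable,
where the clock `c(t, τ) = t - τ` for `τ < t` (and `1` otherwise, an irrelevant positive
modification off the domain of integration). [folklore] -/
theorem stronglyMeasurable_oseenDuhamelIntegrand {u v : ℝ → E → E} {Mu Mv : ℝ}
    (hu : IsBddMeasurableField u Mu) (hv : IsBddMeasurableField v Mv) {ν : ℝ} (hν : 0 < ν)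
    (i : Fin (Module.finrank ℝ E)) :
    StronglyMeasurable (fun q : (ℝ × ℝ) × E =>
      oseenHeat (ν * (if q.1.2 < q.1.1 then q.1.1 - q.1.2 else 1))
        (frameTensor (u q.1.2) (v q.1.2)) i q.2) := by
  have hc : Measurable (fun p : ℝ × ℝ => ν * (if p.2 < p.1 then p.1 - p.2 else 1)) :=
    measurable_const.mul (Measurable.ite (measurableSet_lt measurable_snd measurable_fst)
      (measurable_fst.sub measurable_snd) measurable_const)
  have hc0 : ∀ p : ℝ × ℝ, 0 < ν * (if p.2 < p.1 then p.1 - p.2 else 1) := fun p => by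
    split_ifs with h
    · exact mul_pos hν (sub_pos.2 h)
    · exact mul_pos hν one_pos
  have hG : ∀ j k, StronglyMeasurable (fun q : (ℝ × ℝ) × E => frameTensor (u q.1.2) (v q.1.2) j k q.2) :=
    fun j k => (stronglyMeasurable_frameTensor_uncurry hu.stronglyMeasurable hv.stronglyMeasurable j k).comp_measurable
      ((measurable_snd.comp measurable_fst).prodMk measurable_snd)
  have hGp : ∀ (p : ℝ × ℝ) j k, MemLp (fun y => frameTensor (u p.2) (v p.2) j k y) ∞ volume :=
    fun p j k => (hu.memLp_top_frameTensor hv p.2 j k).1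
  exact stronglyMeasurable_oseenHeat_param (P := ℝ × ℝ)
    (G := fun j k (q : (ℝ × ℝ) × E) => frameTensor (u q.1.2) (v q.1.2) j k q.2) hc hc0 hG le_top hGp i

/-- **Measurability of the Duhamel integrand in `τ` at every point**: for every `t`, `x`,
`τ ↦ (𝒩_{ν(t-τ)} (u(τ) ⊗ v(τ)))ᵢ(x)` is a.e. strongly measurable on `(s, t)`. [folklore] -/
theorem aestronglyMeasurable_oseenDuhamelIntegrand_section {u v : ℝ → E → E} {Mu Mv : ℝ}
    (hu : IsBddMeasurableField u Mu) (hv : IsBddMeasurableField v Mv) {ν : ℝ} (hν : 0 < ν)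
    (s t : ℝ) (i : Fin (Module.finrank ℝ E)) (x : E) :
    AEStronglyMeasurable (fun τ => oseenHeat (ν * (t - τ)) (frameTensor (u τ) (v τ)) i x)
      (volume.restrict (Ioo s t)) := by
  have h := (stronglyMeasurable_oseenDuhamelIntegrand hu hv hν i).comp_measurable
    (g := fun τ : ℝ => (((t, τ) : ℝ × ℝ), x))
    ((measurable_const.prodMk measurable_id).prodMk measurable_const)
  refine (h.aestronglyMeasurable.mono_measure Measure.restrict_le_self).congr ?_
  refine (ae_restrict_iff' measurableSet_Ioo).2 (Eventually.of_forall fun τ hτ => ?_)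
  simp only [Function.comp_apply, if_pos hτ.2]

/-- Joint a.e. measurability of the Duhamel integrand in `(τ, x)` on `(s, t) × E`
(for Fubini against test fields). [folklore] -/
theorem aestronglyMeasurable_oseenDuhamelIntegrand_prod {u v : ℝ → E → E} {Mu Mv : ℝ}
    (hu : IsBddMeasurableField u Mu) (hv : IsBddMeasurableField v Mv) {ν : ℝ} (hν : 0 < ν)
    (s t : ℝ) (i : Fin (Module.finrank ℝ E)) :
    AEStronglyMeasurable (fun q : ℝ × E => oseenHeat (ν * (t - q.1)) (frameTensor (u q.1) (v q.1)) i q.2)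
      ((volume.restrict (Ioo s t)).prod volume) := by
  have h := (stronglyMeasurable_oseenDuhamelIntegrand hu hv hν i).comp_measurable
    (g := fun q : ℝ × E => (((t, q.1) : ℝ × ℝ), q.2))
    ((measurable_const.prodMk measurable_fst).prodMk measurable_snd)
  refine (h.aestronglyMeasurable.mono_measure
    (Measure.prod_mono Measure.restrict_le_self le_rfl)).congr ?_
  have hae : ∀ᵐ q ∂((volume.restrict (Ioo s t)).prod (volume : Measure E)), q.1 ∈ Ioo s t :=
    Measure.quasiMeasurePreserving_fst.ae (ae_restrict_mem measurableSet_Ioo)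
  filter_upwards [hae] with q hq
  simp only [Function.comp_apply, if_pos hq.2]

/-- **Joint measurability of the Duhamel term in `(t, x)`**: for bounded measurable fields,
`(t, x) ↦ oseenHeatDuhamel ν s u v t i x` is strongly measurable (a parametric integral of a
jointly measurable integrand). [folklore] -/
theorem stronglyMeasurable_uncurry_oseenHeatDuhamel {u v : ℝ → E → E} {Mu Mv : ℝ}
    (hu : IsBddMeasurableField u Mu) (hv : IsBddMeasurableField v Mv) {ν : ℝ} (hν : 0 < ν)
    (s : ℝ) (i : Fin (Module.finrank ℝ E)) :
    StronglyMeasurable (fun q : ℝ × E => oseenHeatDuhamel ν s u v q.1 i q.2) := by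
  -- the integrand with the indicator of `{s < τ < t}`, as a function of `((t, x), τ)`
  have hS : MeasurableSet {r : (ℝ × E) × ℝ | s < r.2 ∧ r.2 < r.1.1} :=
    (measurableSet_lt measurable_const measurable_snd).inter
      (measurableSet_lt measurable_snd (measurable_fst.comp measurable_fst))
  have hN := (stronglyMeasurable_oseenDuhamelIntegrand hu hv hν i).comp_measurable
    (g := fun r : (ℝ × E) × ℝ => (((r.1.1, r.2) : ℝ × ℝ), r.1.2))
    (((measurable_fst.comp measurable_fst).prodMk measurable_snd).prodMk
      (measurable_snd.comp measurable_fst))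
  have hI := hN.indicator hS
  have h := hI.integral_prod_right' (ν := (volume : Measure ℝ))
  convert h using 1
  funext q
  rw [oseenHeatDuhamel_apply, ← integral_indicator measurableSet_Ioo]
  congr 1
  funext τ
  simp only [Set.indicator_apply, mem_Ioo, mem_setOf_eq, Function.comp_apply]
  by_cases h1 : s < τ ∧ τ < q.1
  · rw [if_pos h1, if_pos h1, if_pos h1.2]
  · rw [if_neg h1, if_neg h1]


/-! ### The kernel bound, integrability and the `√(t - s)` bound -/

/- The singular weight `(t - τ)^{-1/2}`: integrability on `(s, t)` is the tree's
`intervalIntegrable_rpow_neg_half_sub` (`OseenDuhamelMeasurable.lean`; also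
`integrableOn_Ioo_rpow_neg_half_sub`, `NSBoundedMildSmoothing.lean`), and
`∫_{(s,t)} (t - τ)^{-1/2} dτ = 2 (t - s)^{1/2}` is `integral_rpow_neg_half_sub_eq` (ibid.). -/

variable (hE : Module.finrank ℝ E = 3)
include hE

/-- **The kernel bound of the Duhamel integrand**: for `τ < t`,
`|(𝒩_{ν(t-τ)} (u(τ) ⊗ v(τ)))ᵢ(x)| ≤ 2943 (ν(t-τ))^{-1/2} MᵤMᵥ` (the tree's `L^∞` bound of
`oseenHeat`; KNSS 2009, (3.7): `|K_{ijk}| ≤ C(|x|²+t)^{-(n+1)/2}` integrated in `x`).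
[cite: KochNadirashviliSereginSverak2009, §3 (3.7) and §4 (4.5)] -/
theorem norm_oseenDuhamelIntegrand_le {u v : ℝ → E → E} {Mu Mv : ℝ} (hu : IsBddMeasurableField u Mu)
    (hv : IsBddMeasurableField v Mv) {ν : ℝ} (hν : 0 < ν) {τ t : ℝ} (hτt : τ < t)
    (i : Fin (Module.finrank ℝ E)) (x : E) :
    ‖oseenHeat (ν * (t - τ)) (frameTensor (u τ) (v τ)) i x‖ ≤
      2943 * (ν * (t - τ)) ^ (-(1 / 2 : ℝ)) * (Mu * Mv) :=
  norm_oseenHeat_le_of_top hE (fun j k => (hu.memLp_top_frameTensor hv τ j k).1)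
    (mul_nonneg hu.nonneg hv.nonneg) (fun j k => (hu.memLp_top_frameTensor hv τ j k).2)
    (mul_pos hν (sub_pos.2 hτt)) i x

/-- The Duhamel integrand is integrable on `(s, t)` at every point `x`. [folklore] -/
theorem integrableOn_oseenDuhamelIntegrand {u v : ℝ → E → E} {Mu Mv : ℝ} (hu : IsBddMeasurableField u Mu)
    (hv : IsBddMeasurableField v Mv) {ν : ℝ} (hν : 0 < ν) (s t : ℝ) (i : Fin (Module.finrank ℝ E))
    (x : E) :
    IntegrableOn (fun τ => oseenHeat (ν * (t - τ)) (frameTensor (u τ) (v τ)) i x) (Ioo s t) := by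
  refine Integrable.mono' (g := fun τ => 2943 * ν ^ (-(1 / 2 : ℝ)) * (Mu * Mv) * (t - τ) ^ (-(1 / 2 : ℝ)))
    (((intervalIntegrable_rpow_neg_half_sub s t t).1.mono_set Ioo_subset_Ioc_self).const_mul _)
    (aestronglyMeasurable_oseenDuhamelIntegrand_section hu hv hν s t i x) ?_
  refine (ae_restrict_iff' measurableSet_Ioo).2 (Eventually.of_forall fun τ hτ => ?_)
  calc ‖oseenHeat (ν * (t - τ)) (frameTensor (u τ) (v τ)) i x‖
      ≤ 2943 * (ν * (t - τ)) ^ (-(1 / 2 : ℝ)) * (Mu * Mv) := norm_oseenDuhamelIntegrand_le hE hu hv hν hτ.2 i x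
    _ = 2943 * ν ^ (-(1 / 2 : ℝ)) * (Mu * Mv) * (t - τ) ^ (-(1 / 2 : ℝ)) := by
        rw [Real.mul_rpow hν.le (sub_pos.2 hτ.2).le]; ring

/-- **The `√(t-s)` bound** `|oseenHeatDuhamel ν s u v t i x| ≤ 5886 ν^{-1/2} (t-s)^{1/2} MᵤMᵥ`
(KNSS 2009, (4.5): `‖B(u,v)‖_∞ ≤ C√T‖u‖_∞‖v‖_∞`; Lemarié-Rieusset 2016, proof of Thm. 9.12,
`‖B(v,w)(t)‖_∞ ≤ C₀√T sup‖v‖_∞ sup‖w‖_∞`). [cite: KochNadirashviliSereginSverak2009, §4 (4.5)] -/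
theorem norm_oseenHeatDuhamel_le {u v : ℝ → E → E} {Mu Mv : ℝ} (hu : IsBddMeasurableField u Mu)
    (hv : IsBddMeasurableField v Mv) {ν : ℝ} (hν : 0 < ν) {s t : ℝ} (hst : s ≤ t)
    (i : Fin (Module.finrank ℝ E)) (x : E) :
    ‖oseenHeatDuhamel ν s u v t i x‖ ≤ 5886 * ν ^ (-(1 / 2 : ℝ)) * (t - s) ^ (1 / 2 : ℝ) * (Mu * Mv) := by
  rw [oseenHeatDuhamel_apply]
  refine (norm_integral_le_of_norm_le
    (((intervalIntegrable_rpow_neg_half_sub s t t).1.mono_set Ioo_subset_Ioc_self).const_mul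
      (2943 * ν ^ (-(1 / 2 : ℝ)) * (Mu * Mv))) ?_).trans (le_of_eq ?_)
  · refine (ae_restrict_iff' measurableSet_Ioo).2 (Eventually.of_forall fun τ hτ => ?_)
    calc ‖oseenHeat (ν * (t - τ)) (frameTensor (u τ) (v τ)) i x‖
        ≤ 2943 * (ν * (t - τ)) ^ (-(1 / 2 : ℝ)) * (Mu * Mv) := norm_oseenDuhamelIntegrand_le hE hu hv hν hτ.2 i x
      _ = 2943 * ν ^ (-(1 / 2 : ℝ)) * (Mu * Mv) * (t - τ) ^ (-(1 / 2 : ℝ)) := by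
          rw [Real.mul_rpow hν.le (sub_pos.2 hτ.2).le]; ring
  · rw [integral_const_mul, ← integral_Ioc_eq_integral_Ioo, ← intervalIntegral.integral_of_le hst,
      integral_rpow_neg_half_sub_eq]
    ring

/-- The vector Duhamel term obeys `‖B_s(u,v)(t)(x)‖ ≤ 3 · 5886 ν^{-1/2} (t-s)^{1/2} MᵤMᵥ` in
dimension three. [cite: KochNadirashviliSereginSverak2009, §4 (4.5)] -/
theorem norm_oseenHeatDuhamelVec_le {u v : ℝ → E → E} {Mu Mv : ℝ} (hu : IsBddMeasurableField u Mu)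
    (hv : IsBddMeasurableField v Mv) {ν : ℝ} (hν : 0 < ν) {s t : ℝ} (hst : s ≤ t) (x : E) :
    ‖oseenHeatDuhamelVec ν s u v t x‖ ≤
      3 * (5886 * ν ^ (-(1 / 2 : ℝ)) * (t - s) ^ (1 / 2 : ℝ) * (Mu * Mv)) := by
  rw [oseenHeatDuhamelVec_apply]
  refine (norm_sum_le _ _).trans ?_
  calc ∑ i, ‖oseenHeatDuhamel ν s u v t i x • stdOrthonormalBasis ℝ E i‖
      ≤ ∑ _i : Fin (Module.finrank ℝ E), 5886 * ν ^ (-(1 / 2 : ℝ)) * (t - s) ^ (1 / 2 : ℝ) * (Mu * Mv) := by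
        refine Finset.sum_le_sum fun i _ => ?_
        rw [norm_smul]
        exact (mul_le_of_le_one_right (norm_nonneg _) (norm_stdOrthonormalBasis_le_one i)).trans
          (norm_oseenHeatDuhamel_le hE hu hv hν hst i x)
    _ = 3 * (5886 * ν ^ (-(1 / 2 : ℝ)) * (t - s) ^ (1 / 2 : ℝ) * (Mu * Mv)) := by
        rw [Finset.sum_const, Finset.card_univ, Fintype.card_fin, hE, nsmul_eq_mul]
        push_cast
        ring

omit hE in
/-- **Joint measurability of the vector Duhamel term in `(t, x)`.** [folklore] -/
theorem stronglyMeasurable_uncurry_oseenHeatDuhamelVec {u v : ℝ → E → E} {Mu Mv : ℝ}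
    (hu : IsBddMeasurableField u Mu) (hv : IsBddMeasurableField v Mv) {ν : ℝ} (hν : 0 < ν)
    (s : ℝ) : StronglyMeasurable (uncurry (oseenHeatDuhamelVec ν s u v)) := by
  have : uncurry (oseenHeatDuhamelVec ν s u v) =
      fun q : ℝ × E => ∑ i, oseenHeatDuhamel ν s u v q.1 i q.2 • stdOrthonormalBasis ℝ E i := by
    funext q; rfl
  rw [this]
  exact Finset.stronglyMeasurable_fun_sum _ fun i _ =>
    (stronglyMeasurable_uncurry_oseenHeatDuhamel hu hv hν s i).smul_const _

omit hE in
/-- The slices of the vector Duhamel term are strongly measurable. [folklore] -/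
theorem stronglyMeasurable_oseenHeatDuhamelVec {u v : ℝ → E → E} {Mu Mv : ℝ}
    (hu : IsBddMeasurableField u Mu) (hv : IsBddMeasurableField v Mv) {ν : ℝ} (hν : 0 < ν)
    (s t : ℝ) : StronglyMeasurable (oseenHeatDuhamelVec ν s u v t) :=
  (stronglyMeasurable_uncurry_oseenHeatDuhamelVec hu hv hν s).comp_measurable
    (measurable_const.prodMk measurable_id)

/-! ### Fubini against an `L¹` function -/

/-- **Fubini for a Duhamel component against an `L¹` function**: for `h ∈ L¹`,
`∫ (oseenHeatDuhamel ν s u v t i) h = ∫_{τ∈(s,t)} ∫ (𝒩_{ν(t-τ)}(u ⊗ v))ᵢ h`, the double integrand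
being dominated by `2943 (ν(t-τ))^{-1/2} MᵤMᵥ |h|`; with the integrability of the inner pairing in
`τ`. [folklore] -/
theorem integral_oseenHeatDuhamel_mul {u v : ℝ → E → E} {Mu Mv : ℝ} (hu : IsBddMeasurableField u Mu)
    (hv : IsBddMeasurableField v Mv) {ν : ℝ} (hν : 0 < ν) (s t : ℝ) (i : Fin (Module.finrank ℝ E))
    {h : E → ℝ} (hh : Integrable h) :
    Integrable (fun τ => ∫ x, oseenHeat (ν * (t - τ)) (frameTensor (u τ) (v τ)) i x * h x)
        (volume.restrict (Ioo s t)) ∧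
      ∫ x, oseenHeatDuhamel ν s u v t i x * h x =
        ∫ τ in Ioo s t, ∫ x, oseenHeat (ν * (t - τ)) (frameTensor (u τ) (v τ)) i x * h x := by
  set N : ℝ → E → ℝ := fun τ y => oseenHeat (ν * (t - τ)) (frameTensor (u τ) (v τ)) i y with hN
  -- the double integrand `(y, τ) ↦ N τ y * h y` is integrable on `E × (s, t)`
  have hdom : Integrable (fun z : E × ℝ => ‖h z.1‖ *
      (2943 * ν ^ (-(1 / 2 : ℝ)) * (Mu * Mv) * (t - z.2) ^ (-(1 / 2 : ℝ))))
      ((volume : Measure E).prod (volume.restrict (Ioo s t))) :=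
    hh.norm.mul_prod (((intervalIntegrable_rpow_neg_half_sub s t t).1.mono_set Ioo_subset_Ioc_self).const_mul _)
  have hmeasN : AEStronglyMeasurable (fun z : E × ℝ => N z.2 z.1)
      ((volume : Measure E).prod (volume.restrict (Ioo s t))) :=
    (aestronglyMeasurable_oseenDuhamelIntegrand_prod hu hv hν s t i).prod_swap
  have hmeash : AEStronglyMeasurable (fun z : E × ℝ => h z.1)
      ((volume : Measure E).prod (volume.restrict (Ioo s t))) := hh.aestronglyMeasurable.comp_fst
  have hint : Integrable (Function.uncurry fun (y : E) (τ : ℝ) => N τ y * h y)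
      ((volume : Measure E).prod (volume.restrict (Ioo s t))) := by
    refine hdom.mono' (hmeasN.mul hmeash) ?_
    have hae : ∀ᵐ z : E × ℝ ∂((volume : Measure E).prod (volume.restrict (Ioo s t))), z.2 ∈ Ioo s t :=
      Measure.quasiMeasurePreserving_snd.ae (ae_restrict_mem measurableSet_Ioo)
    filter_upwards [hae] with z hz
    change ‖N z.2 z.1 * h z.1‖ ≤ _
    rw [norm_mul, mul_comm]
    refine mul_le_mul_of_nonneg_left ?_ (norm_nonneg _)
    calc ‖N z.2 z.1‖ ≤ 2943 * (ν * (t - z.2)) ^ (-(1 / 2 : ℝ)) * (Mu * Mv) :=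
          norm_oseenDuhamelIntegrand_le hE hu hv hν hz.2 i z.1
      _ = _ := by rw [Real.mul_rpow hν.le (sub_pos.2 hz.2).le]; ring
  refine ⟨hint.integral_prod_right, ?_⟩
  have hswap := integral_integral_swap hint
  calc ∫ y, oseenHeatDuhamel ν s u v t i y * h y
      = ∫ y, ∫ τ in Ioo s t, N τ y * h y := by
        simp_rw [oseenHeatDuhamel_apply, ← MeasureTheory.integral_mul_const]
        rfl
    _ = ∫ τ in Ioo s t, ∫ y, N τ y * h y := hswap

/-! ### The pairing identity against divergence-free test fields -/

omit hE in
/-- **Frame algebra**: `∑ᵢⱼ (u ⊗ v)ⱼᵢ ∂ⱼ(e^{σΔ}φ)ᵢ = ⟪v, (u·∇) e^{σΔ}φ⟫` pointwise, for a smooth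
compactly supported `φ`. [folklore] -/
theorem sum_sum_frameTensor_mul_heatD1_eq (u v : E → E) {φ : E → E}
    (hφ : FunctionSpaces.IsTestFunctionOn (⊤ : TopologicalSpace.Opens E) φ) (σ : ℝ) (x : E) :
    ∑ i, ∑ j, frameTensor u v j i x *
        heatD1 σ (stdOrthonormalBasis ℝ E j) (fun y => ⟪φ y, stdOrthonormalBasis ℝ E i⟫) x =
      ⟪v x, convect u (UnboundedOperators.heatExtension φ σ) x⟫ := by
  set b := stdOrthonormalBasis ℝ E with hb
  set ψ : E → E := UnboundedOperators.heatExtension φ σ with hψ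
  have hψ1 : ContDiff ℝ 1 ψ :=
    UnboundedOperators.contDiff_heatExtension_of_hasCompactSupport (contDiff_infty.1 hφ.contDiff 1)
      hφ.hasCompactSupport σ
  -- components of the heat extension are heat extensions of components
  have hcomp : ∀ i, (fun y => ⟪φ y, b i⟫) = fun y => (innerSL ℝ (b i)) (φ y) := fun i => by
    funext y; rw [innerSL_apply_apply, real_inner_comm]
  have hD : ∀ i j, heatD1 σ (b j) (fun y => ⟪φ y, b i⟫) x = ⟪fderiv ℝ ψ x (b j), b i⟫ := by
    intro i j
    unfold heatD1
    have h1 : UnboundedOperators.heatExtension (fun y => ⟪φ y, b i⟫) σ = fun y => ⟪ψ y, b i⟫ := by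
      funext y
      rw [hcomp i, UnboundedOperators.heatExtension_clm_comp (innerSL ℝ (b i)) hφ.contDiff.continuous
        hφ.hasCompactSupport σ y, innerSL_apply_apply, real_inner_comm]
    rw [h1, fderiv_inner_apply ℝ (hψ1.differentiable one_ne_zero x) (differentiableAt_const _)]
    simp
  simp_rw [hD, frameTensor_apply, ← hb]
  -- `∑ⱼ ⟪u, bⱼ⟫ ⟪Dψ bⱼ, bᵢ⟫ = ⟪Dψ u, bᵢ⟫` and `∑ᵢ ⟪v, bᵢ⟫ ⟪w, bᵢ⟫ = ⟪v, w⟫`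
  have hlin : ∀ i, ∑ j, ⟪u x, b j⟫ * ⟪v x, b i⟫ * ⟪fderiv ℝ ψ x (b j), b i⟫ =
      ⟪v x, b i⟫ * ⟪fderiv ℝ ψ x (u x), b i⟫ := by
    intro i
    have hrepr : fderiv ℝ ψ x (u x) = ∑ j, ⟪u x, b j⟫ • fderiv ℝ ψ x (b j) := by
      conv_lhs => rw [← b.sum_repr' (u x)]
      rw [map_sum]
      refine Finset.sum_congr rfl fun j _ => ?_
      rw [map_smul, real_inner_comm]
    rw [hrepr, sum_inner, Finset.mul_sum]
    refine Finset.sum_congr rfl fun j _ => ?_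
    rw [inner_smul_left]
    simp only [conj_trivial]
    ring
  simp_rw [hlin]
  calc ∑ i, ⟪v x, b i⟫ * ⟪fderiv ℝ ψ x (u x), b i⟫
      = ∑ i, ⟪v x, b i⟫ * ⟪b i, fderiv ℝ ψ x (u x)⟫ := by simp_rw [real_inner_comm (b _)]
    _ = ⟪v x, fderiv ℝ ψ x (u x)⟫ := b.sum_inner_mul_inner _ _
    _ = ⟪v x, convect u ψ x⟫ := rfl

/-- **The pairing identity of the Duhamel term against divergence-free test fields.** For
bounded measurable fields `u`, `v`, `ν > 0`, and a smooth compactly supported divergence-free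
`φ`, for every `t`:
`∫ ⟪B_s(u,v)(t), φ⟫ = -∫_{τ∈(s,t)} ∫ ⟪v(τ), (u(τ)·∇) e^{ν(t-τ)Δ}φ⟫`
(Fubini in `(τ, x)`, the adjoint identity `integral_sum_oseenHeat_mul_inner_eq` at each `τ`, and the
frame algebra). This is the nonlinear term of the duality form of mild solutions
(`Fluid.IsMildNSSolutionBetween`: `+∫ₛᵗ∫⟪u, (u·∇)e^{ν(t-τ)Δ}φ⟫`), so that
`u(t) = e^{ν(t-s)Δ}u(s) - B_s(u,u)(t)` reproduces the duality identity (Lemarié-Rieusset 2016,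
Thm. 6.1 / Prop. 6.5: mild = very weak; (9.37)). [cite: LemarieRieusset2016, Thm. 6.1 / Prop. 6.5 and (9.37)] -/
theorem integral_inner_oseenHeatDuhamelVec {u v : ℝ → E → E} {Mu Mv : ℝ}
    (hu : IsBddMeasurableField u Mu) (hv : IsBddMeasurableField v Mv) {ν : ℝ} (hν : 0 < ν)
    (s t : ℝ) {φ : E → E} (hφ : FunctionSpaces.IsTestFunctionOn (⊤ : TopologicalSpace.Opens E) φ)
    (hdiv : VectorCalculus.IsDivFree φ) :
    ∫ x, ⟪oseenHeatDuhamelVec ν s u v t x, φ x⟫ =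
      -∫ τ in Ioo s t, ∫ x, ⟪v τ x, convect (u τ) (UnboundedOperators.heatExtension φ (ν * (t - τ))) x⟫ := by
  set b := stdOrthonormalBasis ℝ E with hb
  have hφi : ∀ i, Integrable fun x => ⟪φ x, b i⟫ := fun i =>
    (contDiff_inner_const_of_contDiff hφ.contDiff (b i)).continuous.integrable_of_hasCompactSupport
      (hasCompactSupport_inner_const hφ.hasCompactSupport (b i))
  -- `⟪B, φ⟫ = ∑ᵢ Bᵢ φᵢ`
  have hinner : ∀ x, ⟪oseenHeatDuhamelVec ν s u v t x, φ x⟫ =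
      ∑ i, oseenHeatDuhamel ν s u v t i x * ⟪φ x, b i⟫ := fun x => by
    rw [oseenHeatDuhamelVec_apply, sum_inner]
    refine Finset.sum_congr rfl fun i _ => ?_
    rw [inner_smul_left, real_inner_comm, ← hb]
    simp
  simp_rw [hinner]
  -- integrability of `Bᵢ φᵢ` (bounded × integrable)
  have hBi : ∀ i, Integrable fun x => oseenHeatDuhamel ν s u v t i x * ⟪φ x, b i⟫ := by
    intro i
    rcases le_or_gt t s with hts | hst
    · simp_rw [oseenHeatDuhamel_of_le hts]
      simp
    · have hmeas : AEStronglyMeasurable (oseenHeatDuhamel ν s u v t i) volume :=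
        ((stronglyMeasurable_uncurry_oseenHeatDuhamel hu hv hν s i).comp_measurable
          (measurable_const.prodMk measurable_id)).aestronglyMeasurable
      exact (hφi i).mul_of_top_right (memLp_top_of_bound hmeas _
        (Eventually.of_forall fun x => norm_oseenHeatDuhamel_le hE hu hv hν hst.le i x))
  rw [MeasureTheory.integral_finsetSum _ fun i _ => hBi i]
  -- Fubini for each component
  have hF := fun i => integral_oseenHeatDuhamel_mul hE hu hv hν s t i (hφi i)
  simp_rw [fun i => (hF i).2]
  rw [← MeasureTheory.integral_finsetSum _ fun i _ => (hF i).1, ← MeasureTheory.integral_neg]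
  refine setIntegral_congr_fun measurableSet_Ioo fun τ hτ => ?_
  have hσ : 0 < ν * (t - τ) := mul_pos hν (sub_pos.2 hτ.2)
  have hFτ : ∀ j k, MemLp (frameTensor (u τ) (v τ) j k) ∞ volume := fun j k =>
    (hu.memLp_top_frameTensor hv τ j k).1
  -- the adjoint identity at time `τ`
  have hOi : ∀ i, Integrable (fun x => oseenHeat (ν * (t - τ)) (frameTensor (u τ) (v τ)) i x *
      ⟪φ x, b i⟫) := fun i => (hφi i).mul_of_top_right (memLp_top_oseenHeat hE hFτ hσ i)
  rw [← MeasureTheory.integral_finsetSum _ fun i _ => hOi i,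
    integral_sum_oseenHeat_mul_inner_eq hE hFτ hσ hφ hdiv]
  -- the frame algebra, integrated
  have hP : ∀ i j, Integrable (fun x => frameTensor (u τ) (v τ) j i x *
      heatD1 (ν * (t - τ)) (b j) (fun y => ⟪φ y, b i⟫) x) := fun i j =>
    (memLp_one_iff_integrable.1 (memLp_heatD1 (memLp_one_iff_integrable.2 (hφi i)) le_rfl hσ (b j))).mul_of_top_right
      (hFτ j i)
  rw [show (∑ i, ∑ j, ∫ x, frameTensor (u τ) (v τ) j i x *
      heatD1 (ν * (t - τ)) (b j) (fun y => ⟪φ y, b i⟫) x) =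
      ∫ x, ∑ i, ∑ j, frameTensor (u τ) (v τ) j i x *
        heatD1 (ν * (t - τ)) (b j) (fun y => ⟪φ y, b i⟫) x from by
    rw [MeasureTheory.integral_finsetSum _ fun i _ => integrable_finsetSum _ fun j _ => hP i j]
    exact Finset.sum_congr rfl fun i _ => (MeasureTheory.integral_finsetSum _ fun j _ => hP i j).symm]
  congr 1
  refine integral_congr_ae (Eventually.of_forall fun x => ?_)
  exact sum_sum_frameTensor_mul_heatD1_eq (u τ) (v τ) hφ _ x

/-! ### Weak divergence-freeness -/

/-- **The Duhamel term is weakly divergence free**: `∫ ⟪B_s(u,v)(t), ∇θ⟫ = 0` for every smooth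
compactly supported `θ` (Fubini and `integral_sum_oseenHeat_mul_fderiv_eq_zero` at each `τ`).
(Lemarié-Rieusset 2016, §6.2: the range of `P` is solenoidal; KNSS 2009, §3–4.)
[cite: LemarieRieusset2016, §6.2] -/
theorem isWeaklyDivFree_oseenHeatDuhamelVec {u v : ℝ → E → E} {Mu Mv : ℝ}
    (hu : IsBddMeasurableField u Mu) (hv : IsBddMeasurableField v Mv) {ν : ℝ} (hν : 0 < ν)
    (s t : ℝ) : IsWeaklyDivFree (oseenHeatDuhamelVec ν s u v t) := by
  intro θ hθ
  set b := stdOrthonormalBasis ℝ E with hb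
  have hθ1 : ContDiff ℝ 1 θ := contDiff_infty.1 hθ.contDiff 1
  have hhi : ∀ i, Integrable fun x => fderiv ℝ θ x (b i) := fun i =>
    ((contDiff_fderiv_apply_const_of_succ hθ1 (b i)).continuous).integrable_of_hasCompactSupport
      (hθ.hasCompactSupport.fderiv_apply ℝ (b i))
  -- `⟪B, ∇θ⟫ = ∑ᵢ Bᵢ ∂ᵢθ`
  have hinner : ∀ x, ⟪oseenHeatDuhamelVec ν s u v t x, gradient θ x⟫ =
      ∑ i, oseenHeatDuhamel ν s u v t i x * fderiv ℝ θ x (b i) := fun x => by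
    rw [oseenHeatDuhamelVec_apply, sum_inner]
    refine Finset.sum_congr rfl fun i _ => ?_
    rw [inner_smul_left, inner_gradient_eq_fderiv_apply, ← hb]
    simp
  simp_rw [hinner]
  have hBi : ∀ i, Integrable fun x => oseenHeatDuhamel ν s u v t i x * fderiv ℝ θ x (b i) := by
    intro i
    rcases le_or_gt t s with hts | hst
    · simp_rw [oseenHeatDuhamel_of_le hts]
      simp
    · have hmeas : AEStronglyMeasurable (oseenHeatDuhamel ν s u v t i) volume :=
        ((stronglyMeasurable_uncurry_oseenHeatDuhamel hu hv hν s i).comp_measurable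
          (measurable_const.prodMk measurable_id)).aestronglyMeasurable
      exact (hhi i).mul_of_top_right (memLp_top_of_bound hmeas _
        (Eventually.of_forall fun x => norm_oseenHeatDuhamel_le hE hu hv hν hst.le i x))
  rw [MeasureTheory.integral_finsetSum _ fun i _ => hBi i]
  have hF := fun i => integral_oseenHeatDuhamel_mul hE hu hv hν s t i (hhi i)
  simp_rw [fun i => (hF i).2]
  rw [← MeasureTheory.integral_finsetSum _ fun i _ => (hF i).1]
  refine (setIntegral_congr_fun measurableSet_Ioo fun τ hτ => ?_).trans (MeasureTheory.integral_zero _ _)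
  have hσ : 0 < ν * (t - τ) := mul_pos hν (sub_pos.2 hτ.2)
  have hFτ : ∀ j k, MemLp (frameTensor (u τ) (v τ) j k) ∞ volume := fun j k =>
    (hu.memLp_top_frameTensor hv τ j k).1
  have hOi : ∀ i, Integrable (fun x => oseenHeat (ν * (t - τ)) (frameTensor (u τ) (v τ)) i x *
      fderiv ℝ θ x (b i)) := fun i => (hhi i).mul_of_top_right (memLp_top_oseenHeat hE hFτ hσ i)
  rw [← MeasureTheory.integral_finsetSum _ fun i _ => hOi i]
  exact integral_sum_oseenHeat_mul_fderiv_eq_zero hE hFτ hσ hθ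

end Duhamel

/-! ## Bridge to `driftTensor` / `driftDuhamel` (KNSS drift-mild form, unit viscosity) -/

section Bridge

omit [MeasurableSpace E] [BorelSpace E] in
/-- **`driftTensor` is the frame tensor of the full velocity `U + b` with itself**
(definitionally). [folklore] -/
theorem driftTensor_eq_frameTensor (U : ℝ → E → E) (b : ℝ → E) (σ : ℝ) :
    driftTensor U b σ = frameTensor (fun y => U σ y + b σ) (fun y => U σ y + b σ) :=
  rfl

variable (hE : Module.finrank ℝ E = 3)
include hE

/-- **`driftDuhamel` is the unit-viscosity quadratic case of `oseenHeatDuhamelVec`**: for a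
bounded jointly measurable full velocity `u = U + b` and `s ≤ t`,
`driftDuhamel U b s t x = oseenHeatDuhamelVec 1 s u u t x` (the interval integral over `[s, t]` is
the set integral over `(s, t)`, and the frame sum is pulled out of the integral, each component
integrand being integrable by `integrableOn_oseenDuhamelIntegrand`). [folklore] -/
theorem driftDuhamel_eq_oseenHeatDuhamelVec {U : ℝ → E → E} {b : ℝ → E} {M : ℝ}
    (hu : IsBddMeasurableField (fun σ y => U σ y + b σ) M) {s t : ℝ} (hst : s ≤ t) (x : E) :
    driftDuhamel U b s t x =
      oseenHeatDuhamelVec 1 s (fun σ y => U σ y + b σ) (fun σ y => U σ y + b σ) t x := by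
  rw [driftDuhamel_apply, intervalIntegral.integral_of_le hst, integral_Ioc_eq_integral_Ioo,
    oseenHeatDuhamelVec_apply]
  have hint : ∀ i, IntegrableOn (fun σ => oseenHeat (1 * (t - σ))
      (frameTensor (U σ · + b σ) (U σ · + b σ)) i x) (Ioo s t) := fun i =>
    integrableOn_oseenDuhamelIntegrand hE hu hu one_pos s t i x
  have heq : ∀ σ, (∑ i, oseenHeat (t - σ) (driftTensor U b σ) i x • stdOrthonormalBasis ℝ E i) =
      ∑ i, oseenHeat (1 * (t - σ)) (frameTensor (U σ · + b σ) (U σ · + b σ)) i x •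
        stdOrthonormalBasis ℝ E i := fun σ => by
    rw [one_mul]; rfl
  simp_rw [heq]
  rw [MeasureTheory.integral_finsetSum _ fun i _ => (hint i).smul_const _]
  refine Finset.sum_congr rfl fun i _ => ?_
  rw [integral_smul_const, oseenHeatDuhamel_apply]

end Bridge

end Literature.Analysis.FluidPDE
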